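import Summits.NavierStokesRegularity.FunctionalMining.StretchingLaminateStep
import HarnessLib

/-!
# FunctionalMining — K1-Q1 lamination trees: `LaminateStep → LaminateRealization` (part 2 of 2: the kernel induction and the root bridge)

NS FUNCTIONAL MINING cell (`pub-nsfunc`), dictionary seat gen 8 (split for the 400-line cap by the prove seat gen 6;
text of §§5–6 byte-identical to the staged `StretchingLaminateStep.lean` sha16 8cd96417cfc4f682) — **search for
candidate a priori estimates; no regularity claim**. Static facts about smooth fields on `T³` and a finite rational
calculus; nothing is asserted about Navier–Stokes.

Part 1 (`StretchingLaminateStep.lean`) carries the real matrix statistics, the casts, the statistics `statP/statE`,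
`VortBound`, `Realizable`, the `@[conjecture]` node `LaminateStep`, the tree bookkeeping and the leaf. This part proves
the KERNEL induction `Laminate.realizable_of_step : LaminateStep → ∀ 𝒯 valid, ∀ G trace-free, Realizable 𝒯 G`, the
root bridges (`torusVorticitySqAt_eq_vortSqM`, `torusEnstrophy_eq_integral_halfSqM`, `statP_root`, `statE_root`,
`energy_pos_and_vortSup_pos`), **`laminateRealization_of_step : LaminateStep → LaminateRealization`**, and the corollaries
`d4_le_stretchingSupConst_of_step : LaminateStep → 69/125 ≤ C⋆`, `laminateSupConst_le_stretchingSupConst_of_step :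
LaminateStep → C_lam ≤ C⋆`. [ours]
-/

noncomputable section

open MeasureTheory

namespace Summit.NavierStokesRegularity.FunctionalMining

open Literature.Analysis Literature.Analysis.FunctionSpaces Literature.Analysis.FunctionSpaces.Torus
open Literature.Analysis.FluidPDE Literature.Analysis.FluidPDE.Torus

namespace Laminate

open WrapStretching

/-! ## 5. The kernel induction over the tree -/

/-- **`LaminateStep` ⟹ every valid tree is realizable around every trace-free state** (structural induction:
leaf = zero potential; node = the local node applied to the children's potentials with ceilings
`vortSupFrom G± 𝒯± + ε/4 ⊇ |ω(G±)|²` (barycentre bound), then triangle inequalities). [ours; elementary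
modulo the node] -/
theorem realizable_of_step (hstep : LaminateStep) :
    ∀ T : Tree, T.valid = true → ∀ G : Grad, G.trace = 0 → Realizable T G := by
  intro T
  induction T with
  | leaf =>
    intro _ G hG ε hε
    refine ⟨fun _ => 0, Torus.isSmooth_const _, ?_, ?_, ?_⟩
    · rw [statP_zero_potential G hG]
      simp only [Tree.stretchFrom, one_mul, sub_self, abs_zero]
      exact hε.le
    · rw [statE_zero_potential G]
      simp only [Tree.energyFrom, one_mul, sub_self, abs_zero]
      exact hε.le
    · intro x
      rw [vortSqM_zero_potential]
      simp only [Tree.vortSupFrom]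
      linarith
  | node s p m ihp ihm =>
    intro hT G hG ε hε
    obtain ⟨hl0, hl1, hdot, hp, hm⟩ := Tree.valid_node hT
    have hGp0 : (G.layer (1 - s.lam) s).trace = 0 := by rw [Grad.trace_layer, hG, hdot]; ring
    have hGm0 : (G.layer (-s.lam) s).trace = 0 := by rw [Grad.trace_layer, hG, hdot]; ring
    have hε4 : 0 < ε / 4 := by positivity
    obtain ⟨Ap, hAp, hPp, hEp, hVp⟩ := ihp hp (G.layer (1 - s.lam) s) hGp0 (ε / 4) hε4
    obtain ⟨Am, hAm, hPm, hEm, hVm⟩ := ihm hm (G.layer (-s.lam) s) hGm0 (ε / 4) hε4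
    have hBp : vortSqM (G.layer (1 - s.lam) s).toMat ≤ (p.vortSupFrom (G.layer (1 - s.lam) s) : ℝ) + ε / 4 := by
      rw [toMat_vortSqM]
      have h : ((G.layer (1 - s.lam) s).vortSq : ℝ) ≤ (p.vortSupFrom (G.layer (1 - s.lam) s) : ℝ) := by
        exact_mod_cast Tree.vortSq_le_vortSupFrom p hp _
      linarith
    have hBm : vortSqM (G.layer (-s.lam) s).toMat ≤ (m.vortSupFrom (G.layer (-s.lam) s) : ℝ) + ε / 4 := by
      rw [toMat_vortSqM]
      have h : ((G.layer (-s.lam) s).vortSq : ℝ) ≤ (m.vortSupFrom (G.layer (-s.lam) s) : ℝ) := by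
        exact_mod_cast Tree.vortSq_le_vortSupFrom m hm _
      linarith
    have hl0' : (0 : ℝ) < (s.lam : ℝ) := by exact_mod_cast hl0
    have hl1' : (s.lam : ℝ) < 1 := by exact_mod_cast hl1
    obtain ⟨A, hA, hP, hE, hV⟩ :=
      hstep G s hG hdot hl0 hl1 Ap Am hAp hAm _ _ hBp hBm hVp hVm (ε / 4) hε4
    refine ⟨A, hA, ?_, ?_, ?_⟩
    · rw [stretchFrom_node_one]
      calc |statP G A - ((s.lam : ℝ) * (p.stretchFrom (G.layer (1 - s.lam) s) 1 : ℝ)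
              + (1 - (s.lam : ℝ)) * (m.stretchFrom (G.layer (-s.lam) s) 1 : ℝ))|
          ≤ ε / 4 + (s.lam : ℝ) * (ε / 4) + (1 - (s.lam : ℝ)) * (ε / 4) :=
            abs_combo_le hl0'.le hl1'.le hP hPp hPm
        _ ≤ ε := by linarith
    · rw [energyFrom_node_one]
      calc |statE G A - ((s.lam : ℝ) * (p.energyFrom (G.layer (1 - s.lam) s) 1 : ℝ)
              + (1 - (s.lam : ℝ)) * (m.energyFrom (G.layer (-s.lam) s) 1 : ℝ))|
          ≤ ε / 4 + (s.lam : ℝ) * (ε / 4) + (1 - (s.lam : ℝ)) * (ε / 4) :=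
            abs_combo_le hl0'.le hl1'.le hE hEp hEm
        _ ≤ ε := by linarith
    · intro x
      have hx := hV x
      rw [max_add_add_right] at hx
      rw [vortSupFrom_node]
      push_cast
      linarith

/-! ## 6. The root: bridges to the tree's functionals and `LaminateStep → LaminateRealization` -/

/-- `|ω(v)(x)|² = vortSqM(∇v(x))`. [ours; bookkeeping] -/
theorem torusVorticitySqAt_eq_vortSqM (v : UnitAddTorus (Fin 3) → EuclideanSpace ℝ (Fin 3))
    (x : UnitAddTorus (Fin 3)) : torusVorticitySqAt v x = vortSqM (gradAt v x) := by
  rw [torusVorticitySqAt_eq_sum_sq, vorticityComp_eq_vort, vortSqM_eq_sum_vort_sq]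

/-- `ℰ(v) = ∫ ½|∇v(x)|²_F dx` in the matrix vocabulary. [ours; bookkeeping] -/
theorem torusEnstrophy_eq_integral_halfSqM (v : UnitAddTorus (Fin 3) → EuclideanSpace ℝ (Fin 3)) :
    torusEnstrophy v = ∫ x, halfSqM (gradAt v x) := by
  have h : ∀ x, halfSqM (gradAt v x) = 2⁻¹ * ∑ i, ‖Torus.partialDeriv i v x‖ ^ 2 := by
    intro x
    simp only [halfSqM, gradAt, EuclideanSpace.norm_sq_eq, Real.norm_eq_abs, sq_abs]
    rw [Finset.sum_comm]
    ring
  simp_rw [h]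
  rw [integral_const_mul]
  rfl

/-- Root production bridge: `statP 0 A = σ(curl A)`. [ours; bookkeeping] -/
theorem statP_root (A : UnitAddTorus (Fin 3) → EuclideanSpace ℝ (Fin 3)) (hA : Torus.IsSmooth A) :
    statP Grad.zero A = enstrophyProduction (curlField A) := by
  rw [enstrophyProduction_eq_integral_prodBC (Confinement.isSmooth_curlField hA) (Confinement.isDivFree_curlField hA), statP,
    toMat_zero]
  simp only [zero_add]

/-- Root enstrophy bridge: `statE 0 A = ℰ(curl A)`. [ours; bookkeeping] -/
theorem statE_root (A : UnitAddTorus (Fin 3) → EuclideanSpace ℝ (Fin 3)) :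
    statE Grad.zero A = torusEnstrophy (curlField A) := by
  rw [torusEnstrophy_eq_integral_halfSqM, statE, toMat_zero]
  simp only [zero_add]

/-- In a valid tree with `σ > 0` both `E` and `M²` are positive (from `3σ² ≤ 4M²E²`). [ours; elementary] -/
theorem energy_pos_and_vortSup_pos (T : Tree) (hT : T.valid = true) (hσ : 0 < T.sigma) :
    0 < T.energy ∧ 0 < T.vortSup := by
  have hE0 : 0 ≤ T.energy := Tree.energy_nonneg_of_valid T hT
  have hM0 : 0 ≤ T.vortSup := le_trans (Grad.vortSq_nonneg _) (Tree.vortSq_le_vortSupFrom T hT Grad.zero)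
  have hSL := Tree.sigma_sq_le T hT
  have hσ2 : 0 < T.sigma ^ 2 := by positivity
  constructor
  · rcases hE0.lt_or_eq with h | h
    · exact h
    · exfalso; rw [← h] at hSL; nlinarith
  · rcases hM0.lt_or_eq with h | h
    · exact h
    · exfalso; rw [← h] at hSL; nlinarith

end Laminate

/-- **`LaminateStep → LaminateRealization`**: the tree-global realization node of `StretchingLaminates.lean`
follows from the LOCAL two-scale node by the kernel induction `Laminate.realizable_of_step` at the root state
`G = 0` with `ε = δ·min(σ, E, M²)`, and the bridges `statP 0 A = σ(curl A)`, `statE 0 A = ℰ(curl A)`,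
`|ω|² = vortSqM ∘ ∇`. Search for candidate a priori estimates; no regularity claim. [ours; elementary modulo
the node] -/
theorem laminateRealization_of_step (hstep : LaminateStep) : LaminateRealization := by
  intro T hT hσ δ hδ
  obtain ⟨hEpos, hMpos⟩ := Laminate.energy_pos_and_vortSup_pos T hT hσ
  have hσr : (0 : ℝ) < (T.sigma : ℝ) := by exact_mod_cast hσ
  have hEr : (0 : ℝ) < (T.energy : ℝ) := by exact_mod_cast hEpos
  have hMr : (0 : ℝ) < (T.vortSup : ℝ) := by exact_mod_cast hMpos
  set ε : ℝ := δ * min (T.sigma : ℝ) (min (T.energy : ℝ) (T.vortSup : ℝ)) with hεdef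
  have hmin : 0 < min (T.sigma : ℝ) (min (T.energy : ℝ) (T.vortSup : ℝ)) := lt_min hσr (lt_min hEr hMr)
  have hε : 0 < ε := mul_pos hδ hmin
  have hεσ : ε ≤ δ * (T.sigma : ℝ) := mul_le_mul_of_nonneg_left (min_le_left _ _) hδ.le
  have hεE : ε ≤ δ * (T.energy : ℝ) :=
    mul_le_mul_of_nonneg_left ((min_le_right _ _).trans (min_le_left _ _)) hδ.le
  have hεM : ε ≤ δ * (T.vortSup : ℝ) :=
    mul_le_mul_of_nonneg_left ((min_le_right _ _).trans (min_le_right _ _)) hδ.le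
  obtain ⟨A, hA, hP, hE, hV⟩ :=
    Laminate.realizable_of_step hstep T hT Laminate.Grad.zero Laminate.Grad.trace_zero ε hε
  refine ⟨curlField A, Confinement.isSmooth_curlField hA, Confinement.isDivFree_curlField hA, fun x => ?_, ?_, ?_⟩
  · have hx := hV x
    rw [Laminate.toMat_zero, zero_add, ← Laminate.torusVorticitySqAt_eq_vortSqM] at hx
    have hsup : (T.vortSupFrom Laminate.Grad.zero : ℝ) = (T.vortSup : ℝ) := rfl
    rw [hsup] at hx
    nlinarith
  · rw [← Laminate.statP_root A hA]
    have hsig : (T.stretchFrom Laminate.Grad.zero 1 : ℝ) = (T.sigma : ℝ) := rfl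
    rw [hsig] at hP
    have h1 := (abs_le.mp hP).1
    nlinarith
  · rw [← Laminate.statE_root A]
    have hen : (T.energyFrom Laminate.Grad.zero 1 : ℝ) = (T.energy : ℝ) := rfl
    rw [hen] at hE
    have h2 := (abs_le.mp hE).2
    nlinarith

/-- `LaminateStep → 69/125 ≤ C⋆` (the 4-split kernel certificate `treeD4_cert`). [ours; elementary modulo the node] -/
theorem d4_le_stretchingSupConst_of_step (hstep : LaminateStep) :
    ((69 / 125 : ℚ) : ℝ) ≤ stretchingSupConst (d := Fin 3) :=
  Laminate.le_stretchingSupConst_of_cert (laminateRealization_of_step hstep) Laminate.treeD4 (69 / 125)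
    Laminate.treeD4_cert

/-- `LaminateStep → C_lam ≤ C⋆` (the whole lamination calculus bounds `C⋆` from below). [ours; elementary modulo
the node] -/
theorem laminateSupConst_le_stretchingSupConst_of_step (hstep : LaminateStep) :
    Laminate.laminateSupConst ≤ stretchingSupConst (d := Fin 3) :=
  Laminate.laminateSupConst_le_stretchingSupConst (laminateRealization_of_step hstep)

end Summit.NavierStokesRegularity.FunctionalMining

end
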